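import Mathlib
import HarnessLib
import Summits.PneNP.PneNP.Theorems.CnfIdealGenLengthRankDefectRepresentationsQuadraticWitness
import Summits.PneNP.PneNP.Theorems.CnfIdealGenLengthRankDefectRepresentationsIffTautologyInstability

/-!
# Crux `RankDefectRepresentations` (stmt-PneNP-18923), line `rank-dehn-ladder`: the tautology rung holds at QUADRATIC ratio

CALIBRATION of the (crux-equivalent) stub `stub_tautologyInstability`, transported from the landed calibration of the crux
(`stub_quadraticWitness`: axiom ranks `≤ 4`, clause-product rank `≥ n² − n` for the CNF `{x_i}_i ∪ {¬x_0 ∨ … ∨ ¬x_{n−1}}`):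
reading that unsatisfiable CNF as the tautology `T_n = ¬⋀⋁` (`tr T_n = P_φ` exactly, `tr_negCnfForm`) gives, for EVERY `n`, a
`4`-almost-representation and a tautology of size `≤ 8n + 4` with `rank tr(T_n)(M) ≥ n² − n` — the inner predicate of the stub at
every exponent `c < 2`; its content is the passage from `n²` to `n^{ω(1)}` (a superpolynomial Frege lower bound, `…FregeCeiling`).
HONEST FRAMING: calibration only; the stub, the crux, GL_noncomm and P ≠ NP are NOT touched; F-N2 is a FRONTIER formal rung.
-/

set_option linter.dupNamespace false -- `Summit.PneNP.PneNP.…`: summit = sub-problem name (D-0017)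

namespace Summit.PneNP.PneNP.Theorems.CnfIdealGenLengthRankDefectRepresentationsTautologyQuadratic

open Literature.Computability.Complexity
open Literature.Computability.MetaComplexity
open Literature.Computability.MetaComplexity.NCIPS
open Summit.PneNP.PneNP.Theorems.CnfIdealGenLengthRankDefectRepresentationsQuadraticWitness (stub_quadraticWitness)
open Summit.PneNP.PneNP.Theorems.CnfIdealGenLengthRankDefectRepresentationsIffTautologyInstability
  (tr_negCnfForm size_negCnfForm_le isTautology_negCnfForm)

/-- The calibration CNF `{x_0}, …, {x_{n−1}}, {¬x_0 ∨ … ∨ ¬x_{n−1}}` is unsatisfiable. [folklore] -/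
theorem not_satisfiable_calib (n : ℕ) :
    ¬ CNF.Satisfiable ((((List.finRange n).map fun i => [(i, true)]) ++
      [(List.finRange n).map fun i => (i, false)]) : CNF (Fin n)) := by
  rintro ⟨σ, hσ⟩
  simp only [CNF.eval, List.all_append, List.all_map, Bool.and_eq_true, List.all_eq_true, Function.comp_apply,
    List.any_cons, List.any_nil, Bool.or_false, List.all_cons, List.all_nil, Bool.and_true, List.any_map,
    List.any_eq_true, List.mem_finRange, true_and] at hσ
  obtain ⟨h1, i, hi⟩ := hσ
  have := h1 i
  simp [Literal.eval] at this hi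
  rw [this] at hi
  exact Bool.noConfusion hi

/-- Counting for the calibration CNF: size `2n`, `n + 1` clauses. [folklore] -/
theorem size_calib (n : ℕ) :
    CNF.size ((((List.finRange n).map fun i => [(i, true)]) ++
      [(List.finRange n).map fun i => (i, false)]) : CNF (Fin n)) = 2 * n ∧
    CNF.numClauses ((((List.finRange n).map fun i => [(i, true)]) ++
      [(List.finRange n).map fun i => (i, false)]) : CNF (Fin n)) = n + 1 := by
  constructor
  · simp only [CNF.size, List.map_append, List.map_map, List.sum_append, List.map_cons, List.map_nil, List.sum_cons,
      List.sum_nil, List.length_map, List.length_finRange, Function.comp_def, List.length_cons, List.length_nil]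
    simp; ring
  · simp [CNF.numClauses]

/-- **The tautology rung at quadratic ratio.** For every `n` there are a field of characteristic `0`, a `t`-almost-representation
with `t ≤ 4`, and a propositional TAUTOLOGY `T` of size `≤ 12 (n + 1)` with `n² ≤ 4 (rank tr(T)(M) + n)` (i.e. rank `≥ n² − n`
up to the constant): the inner predicate of `stub_tautologyInstability` for every exponent `c < 2`. [folklore] -/
theorem tautologyInstability_quadratic :
    ∃ C : ℕ, ∀ n : ℕ, ∃ (K : Type) (_ : Field K) (_ : CharZero K) (d t : ℕ)
      (M : Fin n → Matrix (Fin d) (Fin d) K) (T : PropForm (Fin n)),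
      (∀ g : MonoidAlgebra K (FreeMonoid (Fin n)), IsAxiom g →
        (MonoidAlgebra.lift K (Matrix (Fin d) (Fin d) K) (FreeMonoid (Fin n)) (FreeMonoid.lift M) g).rank ≤ t) ∧
      T.IsTautology ∧ T.size ≤ C * (n + 1) ∧ t ≤ C ∧
      n * n ≤ C * ((MonoidAlgebra.lift K (Matrix (Fin d) (Fin d) K) (FreeMonoid (Fin n)) (FreeMonoid.lift M) (tr K T)).rank + n) := by
  obtain ⟨C, hC⟩ := stub_quadraticWitness
  refine ⟨max C 12, fun n => ?_⟩
  obtain ⟨K, iF, iC, d, t, M, hM, ht, hrank⟩ := hC n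
  refine ⟨K, iF, iC, d, t, M, _, hM, isTautology_negCnfForm (K := K) _ (not_satisfiable_calib n), ?_, ?_, ?_⟩
  · refine (size_negCnfForm_le _).trans ?_
    rw [(size_calib n).1, (size_calib n).2]
    have : 12 ≤ max C 12 := le_max_right _ _
    nlinarith
  · exact ht.trans (le_max_left _ _)
  · rw [tr_negCnfForm]
    exact hrank.trans (Nat.mul_le_mul_right _ (le_max_left _ _))

end Summit.PneNP.PneNP.Theorems.CnfIdealGenLengthRankDefectRepresentationsTautologyQuadratic
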